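import Summits.AtomisticToContinuum.HydrodynamicLimit.Theorems.LambertianContactSwapContactAngleEquidistributionEqCentring
import HarnessLib

/-!
# The outgoing flux of a Gibbs-weighted pre-collisional mark as a sum of midpoint-fibre integrals
# (stub `stub_eqFluxMidSum` of line `Sketch` v5, crux `LambertianContactSwap.ContactAngleEquidistribution`,
# stmt-AtomisticToContinuum-12097; lead `prover-line-stmt-AtomisticToContinuum-12097-c2-0`)

WHAT. For `0 < σ < 1/2` (so that the diameter `ε = hsDiameter σ N = σ (N+1)^{-1/3}` satisfies
`0 < ε < 1/2`), every temperature parameter `θ`, every `N` and every measurable `ℝ≥0∞`-valued mark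
`F (y, i, j)` of (pre-collisional configuration, ordered pair), the outgoing collision flux
`outgoingCollisionFlux ε (N+1)` of the Gibbs-weighted transported mark
`w ↦ ρ_N(w) · [i < j] F (collidePair i j w, i, j)` (`ρ_N` the homogeneous canonical Gibbs density
`canonicalDensity` of the constant local Gibbs profile `(1, 0, θ)`) equals the sum over `i < j` of the
MIDPOINT-FIBRE integrals
`∫ dz ∫_{S²} dω (ε² ⟪ω, v_j − v_i⟫)₊ (1_D ρ_N F(·, i, j))(z with xᵢ := xⱼ + (ε/2)ω, xⱼ := xⱼ − (ε/2)ω)`.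

HOW. Pure bookkeeping around two landed results, pair by pair (the structure of the proof of
`outgoingCollisionFlux_pre_congr`): unfold `outgoingCollisionFlux` (a double sum over ordered pairs
with the diagonal removed); for `i < j` the Gibbs weight is invariant under the elastic reflection
`collidePair i j` (`canonicalDensity_collidePair_const`: the collision does not move the particles and
conserves kinetic energy and momentum), so the integrand is the transported mark
`(ρ_N F(·, i, j)) ∘ collidePair i j`, to which `stub_fluxMidpoint` (velocity reflection, Tonelli,
half-diameter shift) applies; for `¬ i < j` both sides vanish (the mark is `0`, and the indicator of the
zero function is zero).

References: C. Cercignani, R. Illner, M. Pulvirenti, *The Mathematical Theory of Dilute Gases*,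
Springer (1994), §4.2, App. 4.A pp. 107–111 (the measure `dσ` on the contact set `Σᵢⱼ`).
-/

noncomputable section

open MeasureTheory Filter Set Topology ProbabilityTheory
open scoped ENNReal BigOperators Classical RealInnerProductSpace

namespace Summit.AtomisticToContinuum.HydrodynamicLimit.Theorems.ContactAngleEquidistributionSketch

open Literature.Analysis.FluidPDE Literature.MathematicalPhysics.KineticTheory

/-- **Registered sub-goal `stub_eqFluxMidSum`** (line `Sketch` v5, crux ContactAngleEquidistribution,
stmt-AtomisticToContinuum-12097): for `0 < σ < 1/2`, every `θ`, `N` and every measurable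
`ℝ≥0∞`-valued mark `F (y, i, j)` of (pre-collisional configuration, ordered pair), the outgoing
collision flux of the Gibbs-weighted transported mark `ρ_N(w) · [i < j] F (collidePair i j w, i, j)` is
the sum over `i < j` of the midpoint-fibre integrals
`∫ dz ∫_{S²} dω (ε²⟪ω, v_j − v_i⟫)₊ (1_D ρ_N F(·, i, j))(mid z i j ω)`, where `mid z i j ω` puts
particle `i` at `x_j + (ε/2)ω` and particle `j` at `x_j − (ε/2)ω` (velocities unchanged): the Gibbs
weight is invariant under the elastic reflection (`canonicalDensity_collidePair_const`) and
`stub_fluxMidpoint` applies pair by pair; the pairs with `¬ i < j` contribute `0` on both sides.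
[cite: CIP1994, App. 4.A pp. 107–111] -/
theorem stub_eqFluxMidSum {σ : ℝ} (hσ : 0 < σ) (hσh : σ < 1 / 2) (θ : ℝ) (N : ℕ)
    (F : Config (N + 1) (Fin 3) T3 → Fin (N + 1) → Fin (N + 1) → ℝ≥0∞)
    (hF : ∀ i j, Measurable fun y => F y i j) :
    outgoingCollisionFlux (hsDiameter σ N) (N + 1) (fun w i j =>
        ENNReal.ofReal (canonicalDensity (Torus.geometry (Fin 3)) (hsDiameter σ N) (N + 1)
          (localGibbsProfile (fun _ => 1) (fun _ => 0) (fun _ => θ)) w) *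
        (if i < j then F (collidePair (Torus.geometry (Fin 3)) i j w) i j else 0)) =
      ∑ i : Fin (N + 1), ∑ j : Fin (N + 1), if i < j then
        ∫⁻ z : Config (N + 1) (Fin 3) T3, ∫⁻ ω : Metric.sphere (0 : V3) 1,
          ENNReal.ofReal (hsDiameter σ N ^ (Fintype.card (Fin 3) - 1) * ⟪((ω : V3)), (z j).2 - (z i).2⟫) *
            (hardSphereDomain (Torus.geometry (Fin 3)) (N + 1) (hsDiameter σ N)).indicator
              (fun y => ENNReal.ofReal (canonicalDensity (Torus.geometry (Fin 3)) (hsDiameter σ N) (N + 1)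
                (localGibbsProfile (fun _ => 1) (fun _ => 0) (fun _ => θ)) y) * F y i j)
              (Function.update (Function.update z i
                  ((z j).1 + Literature.Analysis.FunctionSpaces.Torus.proj ((hsDiameter σ N / 2) • (ω : V3)),
                    (z i).2)) j
                ((z j).1 + Literature.Analysis.FunctionSpaces.Torus.proj (-((hsDiameter σ N / 2) • (ω : V3))),
                  (z j).2))
          ∂(volume : Measure V3).toSphere
        else 0 := by
  have hε0 : 0 < hsDiameter σ N := hsDiameter_pos hσ N
  have hεh : hsDiameter σ N < 1 / 2 := (hsDiameter_le hσ.le N).trans_lt hσh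
  set cD := canonicalDensity (Torus.geometry (Fin 3)) (hsDiameter σ N) (N + 1)
    (localGibbsProfile (fun _ => 1) (fun _ => 0) (fun _ => θ)) with hcD
  have hρm : Measurable fun y : Config (N + 1) (Fin 3) T3 => ENNReal.ofReal (cD y) :=
    (measurable_canonicalDensity (hsDiameter σ N) (N + 1)
      (measurable_localGibbsProfile continuous_const continuous_const continuous_const)).ennreal_ofReal
  simp only [outgoingCollisionFlux]
  refine Finset.sum_congr rfl fun i _ => Finset.sum_congr rfl fun j _ => ?_
  by_cases hlt : i < j
  · -- an ordered pair `i < j`: Gibbs invariance under the reflection, then the midpoint coordinates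
    have hij : i ≠ j := ne_of_lt hlt
    simp only [if_neg hij, if_pos hlt]
    have hpre : ∀ w : Config (N + 1) (Fin 3) T3,
        ENNReal.ofReal (cD w) * F (collidePair (Torus.geometry (Fin 3)) i j w) i j =
          ENNReal.ofReal (cD (collidePair (Torus.geometry (Fin 3)) i j w)) *
            F (collidePair (Torus.geometry (Fin 3)) i j w) i j := fun w => by
      rw [hcD, canonicalDensity_collidePair_const 1 θ 0 (hsDiameter σ N) hij]
    simp only [hpre]
    exact stub_fluxMidpoint hε0 hεh hij (fun y => ENNReal.ofReal (cD y) * F y i j) (hρm.mul (hF i j))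
  · -- `¬ i < j`: the mark vanishes, so do both sides
    by_cases hij : i = j
    · simp only [if_pos hij, if_neg hlt]
    · simp only [if_neg hij, if_neg hlt, mul_zero, Set.indicator_zero, lintegral_zero]

end Summit.AtomisticToContinuum.HydrodynamicLimit.Theorems.ContactAngleEquidistributionSketch

end
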